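import Literature.MathematicalPhysics.QuantumLattice.AngularCutoffFrechetBounds
import Literature.MathematicalPhysics.QuantumLattice.BrillouinZoneCentredPeriodisation
import Mathlib.Analysis.SpecialFunctions.SmoothTransition
import Mathlib.Analysis.InnerProductSpace.Calculus
import Mathlib.Analysis.Calculus.ContDiff.WithLp
import HarnessLib

/-!
# The angular sector cutoff as a SMOOTH PERIODIC factor on the momentum plane

Topic `MathematicalPhysics/QuantumLattice`; continues `AngularCutoffFrechetBounds` (Fréchet bounds of `P ↦ ζ̃_{n,ω}(θ(P))` away from
the origin) and `BrillouinZoneCentredPeriodisation` (`zonePeriodise Ψ = Ψ ∘ c` is smooth, periodic, with the same bounds, when `Ψ`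
vanishes near the zone boundary).  The sector multipliers of Benfatto–Giuliani–Mastropietro 2006, §2.5 (2.45)–(2.48), are
`χ_h(k₀, e(k⃗))·ζ̃_{h,ω}(θ(c(k⃗)))`: the angular factor is evaluated at the CENTRED momentum and is neither periodic nor smooth at
the origin, while the sampled-symbol machinery (`HubbardUVSymbolFibreSampling.norm_fwdDiff_iter₂_comp_mul_sample_le`) wants a real
factor `κ` that is smooth and `2π`-periodic on the plane with global bounds `‖Dⁱκ‖ ≤ Wᵢ`.  Since the radial factor vanishes off a
shell `{r₁ ≤ ‖c‖, |c_i| ≤ π − δ₀}` (the scale-`h` shell of the band avoids the origin and the zone boundary,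
`HubbardScaleZeroSectorSymbolGeometry`), the angular factor may be replaced by

  **`zoneAngular r₁ δ₀ n ω = (ζ̃_{n,ω}∘θ · η_{r₁,δ₀}) ∘ c`**,   `η` a smooth plateau `= 1` on the shell, `= 0` near `0` and near the boundary,

which IS smooth and periodic with global all-order bounds, and agrees with `ζ̃_{n,ω}(θ(c(k⃗)))` on the shell:

* `zoneCoordPlateau δ₀`, `zoneRadialPlateau r₁`, `zonePlateau r₁ δ₀` (built from `Real.smoothTransition`): smooth, `= 1` on the
  shell, `= 0` on `‖P‖ < r₁/2` and on `{∃ i, |P_i| ≥ π − δ₀/2}`, compactly supported; `exists_norm_iteratedFDeriv_zonePlateau_le`;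
* `contDiffAt_sectorWeightCirc_polarAngle_ofLp` (`P ≠ 0`), `zoneAngularRaw`, `contDiff_zoneAngularRaw`,
  `exists_norm_iteratedFDeriv_zoneAngularRaw_le` (Leibniz within `{P ≠ 0}` + the Fréchet bounds at `r₀ = r₁/2`);
* **`zoneAngular`**, **`contDiff_zoneAngular`**, **`zoneAngular_periodic`**, **`exists_norm_iteratedFDeriv_zoneAngular_le`**,
  **`zoneAngular_eq_of_shell`**, **`zoneAngular_latticeMomentum_eq`** (`= ζ̃_{n,ω}(momentumAngle k⃗)` on the shell).

Everything is proved; the four plateau/angular definitions are the only definitions; no named facts.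

## Sources

G. Benfatto, A. Giuliani, V. Mastropietro, Ann. Henri Poincaré 7 (2006) 809–898, §2.5 (2.45)–(2.48), Lemma 2.2, §2.7 (2.71a)
(`BenfattoGiulianiMastropietro2006`).
-/

noncomputable section

namespace Literature.MathematicalPhysics.QuantumLattice

open Real Set Filter Complex Literature.Probability.LatticeModels
open scoped Nat Topology

/-! ### §1 The plateau -/

/-- The coordinate plateau `τ(t)`: smooth, `= 1` for `|t| ≤ π − δ₀`, `= 0` for `|t| ≥ π − δ₀/2`.
[cite: BenfattoGiulianiMastropietro2006, §2.5 (2.45)] -/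
def zoneCoordPlateau (δ₀ t : ℝ) : ℝ :=
  Real.smoothTransition ((π - δ₀ / 2 - t) / (δ₀ / 2)) * Real.smoothTransition ((π - δ₀ / 2 + t) / (δ₀ / 2))

/-- The radial plateau `ρ(P)`: smooth, `= 0` for `‖P‖ ≤ r₁/2`, `= 1` for `‖P‖ ≥ r₁`.
[cite: BenfattoGiulianiMastropietro2006, §2.5 (2.45)] -/
def zoneRadialPlateau (r₁ : ℝ) (P : EuclideanSpace ℝ (Fin 2)) : ℝ :=
  Real.smoothTransition ((‖P‖ ^ 2 - (r₁ / 2) ^ 2) / (r₁ ^ 2 - (r₁ / 2) ^ 2))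

/-- **The shell plateau** `η(P) = ρ(P)·τ(P₀)·τ(P₁)`. [cite: BenfattoGiulianiMastropietro2006, §2.5 (2.45)] -/
def zonePlateau (r₁ δ₀ : ℝ) (P : EuclideanSpace ℝ (Fin 2)) : ℝ :=
  zoneRadialPlateau r₁ P * (zoneCoordPlateau δ₀ (P 0) * zoneCoordPlateau δ₀ (P 1))

/-- `τ` is smooth. [cite: BenfattoGiulianiMastropietro2006, §2.5 Lemma 2.2] -/
theorem contDiff_zoneCoordPlateau (δ₀ : ℝ) {m : ℕ∞} : ContDiff ℝ m (zoneCoordPlateau δ₀) :=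
  (Real.smoothTransition.contDiff.comp ((contDiff_const.sub contDiff_id).div_const _)).mul
    (Real.smoothTransition.contDiff.comp ((contDiff_const.add contDiff_id).div_const _))

/-- `τ = 1` on `|t| ≤ π − δ₀`. [cite: BenfattoGiulianiMastropietro2006, §2.5 (2.45)] -/
theorem zoneCoordPlateau_eq_one {δ₀ t : ℝ} (hδ : 0 < δ₀) (ht : |t| ≤ π - δ₀) : zoneCoordPlateau δ₀ t = 1 := by
  obtain ⟨h1, h2⟩ := abs_le.1 ht
  rw [zoneCoordPlateau, Real.smoothTransition.one_of_one_le, Real.smoothTransition.one_of_one_le, mul_one]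
  · rw [le_div_iff₀ (by positivity)]; linarith
  · rw [le_div_iff₀ (by positivity)]; linarith

/-- `τ = 0` on `|t| ≥ π − δ₀/2`. [cite: BenfattoGiulianiMastropietro2006, §2.5 (2.45)] -/
theorem zoneCoordPlateau_eq_zero {δ₀ t : ℝ} (hδ : 0 < δ₀) (ht : π - δ₀ / 2 ≤ |t|) : zoneCoordPlateau δ₀ t = 0 := by
  rw [zoneCoordPlateau]
  rcases le_abs.1 ht with h | h
  · rw [Real.smoothTransition.zero_of_nonpos, zero_mul]
    rw [div_le_iff₀ (by positivity)]; linarith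
  · rw [mul_comm, Real.smoothTransition.zero_of_nonpos, zero_mul]
    rw [div_le_iff₀ (by positivity)]; linarith

/-- `ρ` is smooth. [cite: BenfattoGiulianiMastropietro2006, §2.5 Lemma 2.2] -/
theorem contDiff_zoneRadialPlateau (r₁ : ℝ) {m : ℕ∞} : ContDiff ℝ m (zoneRadialPlateau r₁) :=
  Real.smoothTransition.contDiff.comp (((contDiff_norm_sq ℝ).sub contDiff_const).div_const _)

/-- `ρ = 1` on `‖P‖ ≥ r₁`. [cite: BenfattoGiulianiMastropietro2006, §2.5 (2.45)] -/
theorem zoneRadialPlateau_eq_one {r₁ : ℝ} (hr : 0 < r₁) {P : EuclideanSpace ℝ (Fin 2)} (hP : r₁ ≤ ‖P‖) :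
    zoneRadialPlateau r₁ P = 1 := by
  rw [zoneRadialPlateau, Real.smoothTransition.one_of_one_le]
  rw [le_div_iff₀ (by nlinarith), one_mul]
  nlinarith [norm_nonneg P]

/-- `ρ = 0` on the open ball `‖P‖ < r₁/2` (indeed on the closed one). [cite: BenfattoGiulianiMastropietro2006, §2.5 (2.45)] -/
theorem zoneRadialPlateau_eq_zero {r₁ : ℝ} (hr : 0 < r₁) {P : EuclideanSpace ℝ (Fin 2)} (hP : ‖P‖ ≤ r₁ / 2) :
    zoneRadialPlateau r₁ P = 0 := by
  rw [zoneRadialPlateau, Real.smoothTransition.zero_of_nonpos]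
  rw [div_le_iff₀ (by nlinarith), zero_mul]
  nlinarith [norm_nonneg P]

/-- **`η` is smooth.** [cite: BenfattoGiulianiMastropietro2006, §2.5 Lemma 2.2] -/
theorem contDiff_zonePlateau (r₁ δ₀ : ℝ) {m : ℕ∞} : ContDiff ℝ m (zonePlateau r₁ δ₀) :=
  (contDiff_zoneRadialPlateau r₁).mul
    (((contDiff_zoneCoordPlateau δ₀).comp (contDiff_piLp_apply (p := 2) (i := (0 : Fin 2)))).mul
      ((contDiff_zoneCoordPlateau δ₀).comp (contDiff_piLp_apply (p := 2) (i := (1 : Fin 2)))))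

/-- **`η = 1` on the shell** `r₁ ≤ ‖P‖`, `|P_i| ≤ π − δ₀`. [cite: BenfattoGiulianiMastropietro2006, §2.5 (2.45)] -/
theorem zonePlateau_eq_one {r₁ δ₀ : ℝ} (hr : 0 < r₁) (hδ : 0 < δ₀) {P : EuclideanSpace ℝ (Fin 2)} (hP : r₁ ≤ ‖P‖)
    (hb : ∀ i, |P i| ≤ π - δ₀) : zonePlateau r₁ δ₀ P = 1 := by
  rw [zonePlateau, zoneRadialPlateau_eq_one hr hP, zoneCoordPlateau_eq_one hδ (hb 0), zoneCoordPlateau_eq_one hδ (hb 1)]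
  ring

/-- **`η = 0` on the boundary strip** `{∃ i, |P_i| ≥ π − δ₀/2}`. [cite: BenfattoGiulianiMastropietro2006, §2.5 (2.45)] -/
theorem zonePlateau_eq_zero_of_strip {r₁ δ₀ : ℝ} (hδ : 0 < δ₀) {P : EuclideanSpace ℝ (Fin 2)}
    (hP : ∃ i, π - δ₀ / 2 ≤ |P i|) : zonePlateau r₁ δ₀ P = 0 := by
  rw [zonePlateau]
  rcases Fin.exists_fin_two.1 hP with hi | hi
  · rw [zoneCoordPlateau_eq_zero hδ hi]; ring
  · rw [zoneCoordPlateau_eq_zero hδ hi]; ring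

/-- **`η = 0` near the origin**: on `‖P‖ ≤ r₁/2`. [cite: BenfattoGiulianiMastropietro2006, §2.5 (2.45)] -/
theorem zonePlateau_eq_zero_of_norm_le {r₁ δ₀ : ℝ} (hr : 0 < r₁) {P : EuclideanSpace ℝ (Fin 2)} (hP : ‖P‖ ≤ r₁ / 2) :
    zonePlateau r₁ δ₀ P = 0 := by
  rw [zonePlateau, zoneRadialPlateau_eq_zero hr hP, zero_mul]

/-- A point of the plane with both coordinates at most `π` in size has norm at most `2π`.
[cite: BenfattoGiulianiMastropietro2006, §2.5 (2.45)] -/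
theorem norm_le_two_pi_of_abs_apply_le {P : EuclideanSpace ℝ (Fin 2)} (h : ∀ i, |P i| ≤ π) : ‖P‖ ≤ 2 * π := by
  rw [EuclideanSpace.norm_eq, Fin.sum_univ_two, Real.norm_eq_abs, Real.norm_eq_abs]
  have h0 := h 0
  have h1 := h 1
  have hπ := pi_pos.le
  calc √(|P 0| ^ 2 + |P 1| ^ 2) ≤ √((2 * π) ^ 2) := Real.sqrt_le_sqrt (by nlinarith [abs_nonneg (P 0), abs_nonneg (P 1)])
    _ = 2 * π := Real.sqrt_sq (by positivity)

/-- **`η` is compactly supported** (in the closed ball of radius `2π`). [cite: BenfattoGiulianiMastropietro2006, §2.5 (2.45)] -/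
theorem hasCompactSupport_zonePlateau {r₁ δ₀ : ℝ} (hδ : 0 < δ₀) : HasCompactSupport (zonePlateau r₁ δ₀) := by
  refine HasCompactSupport.intro (isCompact_closedBall (0 : EuclideanSpace ℝ (Fin 2)) (2 * π)) fun P hP => ?_
  rw [Metric.mem_closedBall, dist_zero_right, not_le] at hP
  apply zonePlateau_eq_zero_of_strip hδ
  by_contra h
  push Not at h
  have hle : ∀ i, |P i| ≤ π := fun i => by linarith [h i, hδ]
  exact (norm_le_two_pi_of_abs_apply_le hle).not_gt hP

/-- **All-order bounds of `η`** (continuity on a compact support). [cite: BenfattoGiulianiMastropietro2006, §2.5 Lemma 2.2] -/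
theorem exists_norm_iteratedFDeriv_zonePlateau_le {r₁ δ₀ : ℝ} (hδ : 0 < δ₀) (N : ℕ) :
    ∃ W : ℝ, 0 ≤ W ∧ ∀ i ≤ N, ∀ P, ‖iteratedFDeriv ℝ i (zonePlateau r₁ δ₀) P‖ ≤ W := by
  have h : ∀ i : ℕ, ∃ C : ℝ, ∀ P, ‖iteratedFDeriv ℝ i (zonePlateau r₁ δ₀) P‖ ≤ C := fun i =>
    ((hasCompactSupport_zonePlateau (r₁ := r₁) hδ).iteratedFDeriv i).exists_bound_of_continuous
      ((contDiff_zonePlateau r₁ δ₀ (m := i)).continuous_iteratedFDeriv le_rfl)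
  choose C hC using h
  refine ⟨∑ i ∈ Finset.range (N + 1), |C i|, Finset.sum_nonneg fun i _ => abs_nonneg _, fun i hi P => ?_⟩
  calc ‖iteratedFDeriv ℝ i (zonePlateau r₁ δ₀) P‖ ≤ |C i| := (hC i P).trans (le_abs_self _)
    _ ≤ ∑ j ∈ Finset.range (N + 1), |C j| :=
        Finset.single_le_sum (f := fun j => |C j|) (fun j _ => abs_nonneg _) (Finset.mem_range.2 (Nat.lt_succ_of_le hi))

/-! ### §2 The raw angular factor `ζ̃_{n,ω}(θ(P))·η(P)` on the plane -/

/-- **The angular cutoff is smooth away from the origin** (Euclidean-plane form of `contDiffAt_sectorWeightCirc_polarAngle`).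
[cite: BenfattoGiulianiMastropietro2006, §2.5 Lemma 2.2] -/
theorem contDiffAt_sectorWeightCirc_polarAngle_ofLp (n : ℕ) (ω : ℤ) {P : EuclideanSpace ℝ (Fin 2)} (hP : P ≠ 0) {m : ℕ∞} :
    ContDiffAt ℝ m (fun P : EuclideanSpace ℝ (Fin 2) => sectorWeightCirc n ω (polarAngle (WithLp.ofLp P))) P := by
  have hk : WithLp.ofLp P ≠ 0 := fun h => hP ((WithLp.ofLp_eq_zero 2).1 h)
  exact (contDiffAt_sectorWeightCirc_polarAngle n ω hk).comp P (PiLp.contDiff_ofLp (p := 2)).contDiffAt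

/-- **The raw angular factor** `Ψ_{n,ω}(P) = ζ̃_{n,ω}(θ(P))·η(P)` on the Euclidean plane.
[cite: BenfattoGiulianiMastropietro2006, §2.5 (2.45)–(2.48)] -/
def zoneAngularRaw (r₁ δ₀ : ℝ) (n : ℕ) (ω : ℤ) (P : EuclideanSpace ℝ (Fin 2)) : ℝ :=
  sectorWeightCirc n ω (polarAngle (WithLp.ofLp P)) * zonePlateau r₁ δ₀ P

/-- Near the origin the raw factor vanishes identically. [cite: BenfattoGiulianiMastropietro2006, §2.5 (2.45)] -/
theorem zoneAngularRaw_eventuallyEq_zero {r₁ δ₀ : ℝ} (hr : 0 < r₁) (n : ℕ) (ω : ℤ) {P : EuclideanSpace ℝ (Fin 2)}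
    (hP : ‖P‖ < r₁ / 2) : zoneAngularRaw r₁ δ₀ n ω =ᶠ[𝓝 P] fun _ => 0 := by
  filter_upwards [continuous_norm.continuousAt.eventually_mem (Iio_mem_nhds hP)] with P' hP'
  rw [zoneAngularRaw, zonePlateau_eq_zero_of_norm_le hr (le_of_lt hP'), mul_zero]

/-- **The raw factor is smooth on the whole plane.** [cite: BenfattoGiulianiMastropietro2006, §2.5 Lemma 2.2] -/
theorem contDiff_zoneAngularRaw {r₁ δ₀ : ℝ} (hr : 0 < r₁) (n : ℕ) (ω : ℤ) {m : ℕ∞} :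
    ContDiff ℝ m (zoneAngularRaw r₁ δ₀ n ω) := by
  refine contDiff_iff_contDiffAt.2 fun P => ?_
  by_cases hP : ‖P‖ < r₁ / 2
  · exact (contDiff_const.contDiffAt).congr_of_eventuallyEq (zoneAngularRaw_eventuallyEq_zero hr n ω hP)
  · have hP0 : P ≠ 0 := by
      intro h; rw [h, norm_zero] at hP; exact hP (by positivity)
    exact (contDiffAt_sectorWeightCirc_polarAngle_ofLp n ω hP0).mul (contDiff_zonePlateau r₁ δ₀).contDiffAt

/-- The raw factor vanishes on the boundary strip `{∃ i, |P_i| ≥ π − δ₀/2}`. [cite: BenfattoGiulianiMastropietro2006, §2.5 (2.45)] -/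
theorem zoneAngularRaw_eq_zero_of_strip {r₁ δ₀ : ℝ} (hδ : 0 < δ₀) (n : ℕ) (ω : ℤ) (P : EuclideanSpace ℝ (Fin 2))
    (hP : ∃ i, π - δ₀ / 2 ≤ |P i|) : zoneAngularRaw r₁ δ₀ n ω P = 0 := by
  rw [zoneAngularRaw, zonePlateau_eq_zero_of_strip hδ hP, mul_zero]

/-- **All-order global bounds of the raw factor, uniform in `ω`** (Leibniz within `{P ≠ 0}` with the Fréchet bounds of the angular
cutoff at `r₀ = r₁/2`; zero near the origin). [cite: BenfattoGiulianiMastropietro2006, §2.5 Lemma 2.2] -/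
theorem exists_norm_iteratedFDeriv_zoneAngularRaw_le {r₁ δ₀ : ℝ} (hr : 0 < r₁) (hδ : 0 < δ₀) (N n : ℕ) :
    ∃ W : ℝ, 0 ≤ W ∧ ∀ i ≤ N, ∀ (ω : ℤ) (P : EuclideanSpace ℝ (Fin 2)), ‖iteratedFDeriv ℝ i (zoneAngularRaw r₁ δ₀ n ω) P‖ ≤ W := by
  obtain ⟨B, hB0, hB⟩ := exists_norm_iteratedFDeriv_sectorWeightCirc_polarAngle_le N
  obtain ⟨Wη, hWη0, hWη⟩ := exists_norm_iteratedFDeriv_zonePlateau_le (r₁ := r₁) hδ N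
  -- the angular bound at `r₀ = r₁/2`, all orders `≤ N`
  set b : ℝ := max 1 ((1 + (sectorWidth n)⁻¹ * N !) / (r₁ / 2)) with hb
  set A : ℝ := N ! * B * b ^ N with hA
  have hb1 : 1 ≤ b := le_max_left _ _
  have hA0 : 0 ≤ A := by positivity
  refine ⟨2 ^ N * A * Wη, by positivity, fun i hi ω P => ?_⟩
  by_cases hP : ‖P‖ < r₁ / 2
  · rw [((zoneAngularRaw_eventuallyEq_zero hr n ω hP).iteratedFDeriv ℝ i).eq_of_nhds, iteratedFDeriv_fun_zero, Pi.zero_apply,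
      norm_zero]
    positivity
  · push Not at hP
    have hP0 : P ≠ 0 := by
      intro h; rw [h, norm_zero] at hP; linarith
    -- Leibniz within the open set `{P ≠ 0}`
    set s : Set (EuclideanSpace ℝ (Fin 2)) := {Q | Q ≠ 0} with hs
    have hso : IsOpen s := isOpen_ne
    have hPs : P ∈ s := hP0
    have hf : ContDiffOn ℝ N (fun Q : EuclideanSpace ℝ (Fin 2) => sectorWeightCirc n ω (polarAngle (WithLp.ofLp Q))) s :=
      fun Q hQ => (contDiffAt_sectorWeightCirc_polarAngle_ofLp n ω hQ).contDiffWithinAt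
    have hg : ContDiffOn ℝ N (zonePlateau r₁ δ₀) s := (contDiff_zonePlateau r₁ δ₀).contDiffOn
    have hL := norm_iteratedFDerivWithin_mul_le (N := (N : WithTop ℕ∞)) hf hg hso.uniqueDiffOn hPs (n := i) (by exact_mod_cast hi)
    rw [show (fun y => sectorWeightCirc n ω (polarAngle (WithLp.ofLp y)) * zonePlateau r₁ δ₀ y) = zoneAngularRaw r₁ δ₀ n ω from rfl,
      iteratedFDerivWithin_of_isOpen i hso hPs] at hL
    refine hL.trans ?_
    -- termwise: `C(i,j)·(N! B bʲ)·Wη ≤ C(i,j)·A·Wη`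
    have hterm : ∀ j ∈ Finset.range (i + 1), (i.choose j : ℝ) *
        ‖iteratedFDerivWithin ℝ j (fun Q : EuclideanSpace ℝ (Fin 2) => sectorWeightCirc n ω (polarAngle (WithLp.ofLp Q))) s P‖ *
          ‖iteratedFDerivWithin ℝ (i - j) (zonePlateau r₁ δ₀) s P‖ ≤ (i.choose j : ℝ) * A * Wη := by
      intro j hj
      have hji : j ≤ i := Nat.lt_succ_iff.1 (Finset.mem_range.1 hj)
      rw [iteratedFDerivWithin_of_isOpen j hso hPs, iteratedFDerivWithin_of_isOpen (i - j) hso hPs]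
      have h1 := hB j (hji.trans hi) n ω P (half_pos hr) hP
      have h1' : ‖iteratedFDeriv ℝ j (fun Q : EuclideanSpace ℝ (Fin 2) => sectorWeightCirc n ω (polarAngle (WithLp.ofLp Q))) P‖ ≤ A := by
        refine h1.trans (mul_le_mul_of_nonneg_left ?_ (by positivity))
        calc ((1 + (sectorWidth n)⁻¹ * N !) / (r₁ / 2)) ^ j ≤ b ^ j :=
              pow_le_pow_left₀ (by have := sectorWidth_pos n; positivity) (le_max_right _ _) j
          _ ≤ b ^ N := pow_le_pow_right₀ hb1 (hji.trans hi)
      have h2 := hWη (i - j) (by omega) P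
      exact mul_le_mul (mul_le_mul_of_nonneg_left h1' (Nat.cast_nonneg _)) h2 (norm_nonneg _) (by positivity)
    refine (Finset.sum_le_sum hterm).trans ?_
    rw [← Finset.sum_mul, ← Finset.sum_mul]
    refine mul_le_mul_of_nonneg_right (mul_le_mul_of_nonneg_right ?_ hA0) hWη0
    have hsum : ∑ j ∈ Finset.range (i + 1), (i.choose j : ℝ) = 2 ^ i := by exact_mod_cast Nat.sum_range_choose i
    rw [hsum]
    exact pow_le_pow_right₀ (by norm_num) hi

/-! ### §3 The periodic angular factor -/

/-- **The smooth periodic angular factor** `(ζ̃_{n,ω}∘θ · η) ∘ c`. [cite: BenfattoGiulianiMastropietro2006, §2.5 (2.45)–(2.48)] -/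
def zoneAngular (r₁ δ₀ : ℝ) (n : ℕ) (ω : ℤ) : EuclideanSpace ℝ (Fin 2) → ℝ :=
  zonePeriodise (zoneAngularRaw r₁ δ₀ n ω)

/-- **It is smooth.** [cite: BenfattoGiulianiMastropietro2006, §2.5 Lemma 2.2] -/
theorem contDiff_zoneAngular {r₁ δ₀ : ℝ} (hr : 0 < r₁) (hδ : 0 < δ₀) (n : ℕ) (ω : ℤ) {m : ℕ∞} :
    ContDiff ℝ m (zoneAngular r₁ δ₀ n ω) :=
  contDiff_zonePeriodise (contDiff_zoneAngularRaw hr n ω) (half_pos hδ) (zoneAngularRaw_eq_zero_of_strip hδ n ω)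

/-- **It is `2π`-periodic in both coordinates** (the `hperκ` hypothesis of the sampling lemmas).
[cite: BenfattoGiulianiMastropietro2006, §2.1 (2.3)] -/
theorem zoneAngular_periodic (r₁ δ₀ : ℝ) (n : ℕ) (ω : ℤ) (p : Fin 2 → ℝ) (z : Fin 2 → ℤ) :
    zoneAngular r₁ δ₀ n ω (WithLp.toLp 2 (fun i => p i + z i * (2 * π))) = zoneAngular r₁ δ₀ n ω (WithLp.toLp 2 p) :=
  zonePeriodise_periodic _ p z

/-- **Its all-order global bounds, uniform in `ω`.** [cite: BenfattoGiulianiMastropietro2006, §2.5 Lemma 2.2] -/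
theorem exists_norm_iteratedFDeriv_zoneAngular_le {r₁ δ₀ : ℝ} (hr : 0 < r₁) (hδ : 0 < δ₀) (N n : ℕ) :
    ∃ W : ℝ, 0 ≤ W ∧ ∀ i ≤ N, ∀ (ω : ℤ) (P : EuclideanSpace ℝ (Fin 2)), ‖iteratedFDeriv ℝ i (zoneAngular r₁ δ₀ n ω) P‖ ≤ W := by
  obtain ⟨W, hW0, hW⟩ := exists_norm_iteratedFDeriv_zoneAngularRaw_le hr hδ N n
  exact ⟨W, hW0, fun i hi ω P =>
    norm_iteratedFDeriv_zonePeriodise_le (half_pos hδ) (zoneAngularRaw_eq_zero_of_strip hδ n ω) (fun x => hW i hi ω x) P⟩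

/-- **On the shell it is the angular cutoff of the centred momentum**: for `r₁ ≤ ‖c(p)‖` and `|c(p)_i| ≤ π − δ₀`,
`zoneAngular r₁ δ₀ n ω p = ζ̃_{n,ω}(θ(c(p)))`. [cite: BenfattoGiulianiMastropietro2006, §2.5 (2.45)–(2.48)] -/
theorem zoneAngular_eq_of_shell {r₁ δ₀ : ℝ} (hr : 0 < r₁) (hδ : 0 < δ₀) (n : ℕ) (ω : ℤ) {p : Fin 2 → ℝ}
    (hshell : r₁ ≤ ‖(WithLp.toLp 2 (zoneCentred p) : EuclideanSpace ℝ (Fin 2))‖) (hb : ∀ i, |zoneCentred p i| ≤ π - δ₀) :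
    zoneAngular r₁ δ₀ n ω (WithLp.toLp 2 p) = sectorWeightCirc n ω (polarAngle (zoneCentred p)) := by
  rw [zoneAngular, zonePeriodise_apply, WithLp.ofLp_toLp, zoneAngularRaw, WithLp.ofLp_toLp,
    zonePlateau_eq_one hr hδ hshell (fun i => by rw [PiLp.toLp_apply]; exact hb i), mul_one]

/-- **Lattice form**: at a torus momentum `k⃗` whose centred representative lies in the shell,
`zoneAngular r₁ δ₀ n ω (p_{k⃗}) = ζ̃_{n,ω}(momentumAngle k⃗)`. [cite: BenfattoGiulianiMastropietro2006, §2.5 (2.45)–(2.48)] -/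
theorem zoneAngular_latticeMomentum_eq {L : ℕ} {r₁ δ₀ : ℝ} (hr : 0 < r₁) (hδ : 0 < δ₀) (n : ℕ) (ω : ℤ) (k : TorusSite 2 L)
    (hshell : r₁ ≤ ‖momToComplex (torusCentredMomentum L k)‖) (hb : ∀ i, |torusCentredMomentum L k i| ≤ π - δ₀) :
    zoneAngular r₁ δ₀ n ω (WithLp.toLp 2 (latticeMomentum L k)) = sectorWeightCirc n ω (momentumAngle L k) := by
  have hshell' : r₁ ≤ ‖(WithLp.toLp 2 (zoneCentred (latticeMomentum L k)) : EuclideanSpace ℝ (Fin 2))‖ := by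
    rw [← norm_momToComplex_ofLp, WithLp.ofLp_toLp, ← torusCentredMomentum_eq_zoneCentred]; exact hshell
  rw [zoneAngular_eq_of_shell hr hδ n ω hshell' (fun i => by rw [← torusCentredMomentum_eq_zoneCentred]; exact hb i),
    momentumAngle, torusCentredMomentum_eq_zoneCentred]

end Literature.MathematicalPhysics.QuantumLattice
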